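import Summits.CriticalPhenomena.SAWScalingLimit.Theorems.SAWDefectDecoherenceBoundaryClosureRInnerPolygonsHalfLattice
import Mathlib.Analysis.SpecialFunctions.Complex.Arg
import HarnessLib

/-!
# Crux `BoundaryClosureR` (stmt-CriticalPhenomena-14004), line `polygon-parity-squeeze`,
# stub `boundaryPhaseBookkeeping` (piece D): genuine zigzag corners are wedges

The convex corner `H_k ∩ H_{k'}` and the reflex corner `H_k ∪ H_{k'}` of two zigzag half-planes
through `c` with `n_{k'} ≠ ± n_k` are open wedges at `c` in the form consumed by the landed
corner structure theorem `cornerStructure`: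
`{w ≠ c ∧ |arg((w - c) e^{-iψ})| < θπ/2}` with bisector `e^{iψ} = (n_k + n_{k'})/‖n_k + n_{k'}‖`
and `θ = 1 ∓ 2|γ|/π ∈ (0, 1)` resp. `(1, 2)`, where `e^{iγ} = n_k e^{-iψ}`
(`wedge_presentation`).  In the rotated variable `x = (w - c) e^{-iψ}` the two levels are
`‖x‖ cos(arg x ∓ γ)`, and for `|η| ≤ π`, `|γ| < π/2` one has
`cos(η - γ) > 0 ∧ cos(η + γ) > 0 ↔ |η| < π/2 - |γ|`, `… ∨ … ↔ |η| < π/2 + |γ|`.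

All statements are folklore plane trigonometry; no proposition is defined.
-/

noncomputable section

open scoped ComplexConjugate
open Set Complex

namespace Summit.CriticalPhenomena.SAWScalingLimit.Theorems.PolygonParitySqueeze

namespace PhaseGeometry

/-! ### 1. Signs of cosines -/

/-- For `|y| < 3π/2`: `cos y > 0 ↔ |y| < π/2`. [folklore] -/
theorem cos_pos_iff_abs_lt {y : ℝ} (hy : |y| < 3 * Real.pi / 2) :
    0 < Real.cos y ↔ |y| < Real.pi / 2 := by
  constructor
  · intro h
    by_contra hle
    push Not at hle
    have h1 : Real.cos |y| ≤ 0 := Real.cos_nonpos_of_pi_div_two_le_of_le hle (by linarith)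
    rw [Real.cos_abs] at h1
    linarith
  · intro h
    rw [← Real.cos_abs]
    exact Real.cos_pos_of_mem_Ioo ⟨by linarith [abs_nonneg y], h⟩

/-- For `|η| ≤ π`, `|γ| < π/2`: `cos(η - γ) > 0 ∧ cos(η + γ) > 0 ↔ |η| < π/2 - |γ|`. [folklore] -/
theorem cos_and_cos_pos_iff {η γ : ℝ} (hη : |η| ≤ Real.pi) (hγ : |γ| < Real.pi / 2) :
    (0 < Real.cos (η - γ) ∧ 0 < Real.cos (η + γ)) ↔ |η| < Real.pi / 2 - |γ| := by
  have hη' := abs_le.1 hη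
  have hγ' := abs_lt.1 hγ
  have h1 : |η - γ| < 3 * Real.pi / 2 := abs_lt.2 ⟨by linarith, by linarith⟩
  have h2 : |η + γ| < 3 * Real.pi / 2 := abs_lt.2 ⟨by linarith, by linarith⟩
  rw [cos_pos_iff_abs_lt h1, cos_pos_iff_abs_lt h2, abs_lt, abs_lt, abs_lt]
  rcases abs_cases γ with ⟨hg, _⟩ | ⟨hg, _⟩ <;> rw [hg] <;> constructor
  · rintro ⟨⟨a1, a2⟩, ⟨b1, b2⟩⟩; exact ⟨by linarith, by linarith⟩
  · rintro ⟨c1, c2⟩; exact ⟨⟨by linarith, by linarith⟩, ⟨by linarith, by linarith⟩⟩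
  · rintro ⟨⟨a1, a2⟩, ⟨b1, b2⟩⟩; exact ⟨by linarith, by linarith⟩
  · rintro ⟨c1, c2⟩; exact ⟨⟨by linarith, by linarith⟩, ⟨by linarith, by linarith⟩⟩

/-- For `|η| ≤ π`, `|γ| < π/2`: `cos(η - γ) > 0 ∨ cos(η + γ) > 0 ↔ |η| < π/2 + |γ|`. [folklore] -/
theorem cos_or_cos_pos_iff {η γ : ℝ} (hη : |η| ≤ Real.pi) (hγ : |γ| < Real.pi / 2) :
    (0 < Real.cos (η - γ) ∨ 0 < Real.cos (η + γ)) ↔ |η| < Real.pi / 2 + |γ| := by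
  have hη' := abs_le.1 hη
  have hγ' := abs_lt.1 hγ
  have h1 : |η - γ| < 3 * Real.pi / 2 := abs_lt.2 ⟨by linarith, by linarith⟩
  have h2 : |η + γ| < 3 * Real.pi / 2 := abs_lt.2 ⟨by linarith, by linarith⟩
  rw [cos_pos_iff_abs_lt h1, cos_pos_iff_abs_lt h2, abs_lt, abs_lt, abs_lt]
  rcases abs_cases γ with ⟨hg, _⟩ | ⟨hg, _⟩ <;> rw [hg] <;> constructor
  · rintro (⟨a1, a2⟩ | ⟨a1, a2⟩) <;> exact ⟨by linarith, by linarith⟩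
  · rintro ⟨c1, c2⟩
    rcases le_or_gt 0 η with he | he
    · exact Or.inl ⟨by linarith, by linarith⟩
    · exact Or.inr ⟨by linarith, by linarith⟩
  · rintro (⟨a1, a2⟩ | ⟨a1, a2⟩) <;> exact ⟨by linarith, by linarith⟩
  · rintro ⟨c1, c2⟩
    rcases le_or_gt 0 η with he | he
    · exact Or.inr ⟨by linarith, by linarith⟩
    · exact Or.inl ⟨by linarith, by linarith⟩

/-! ### 2. Unit complex numbers -/

/-- A unit complex number other than `-1` has real part `> -1`. [folklore] -/
theorem neg_one_lt_re_of_unit {ζ : ℂ} (h1 : ‖ζ‖ = 1) (hne : ζ ≠ -1) : -1 < ζ.re := by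
  have hle : -1 ≤ ζ.re := by
    have := neg_abs_le ζ.re
    have := abs_re_le_norm ζ
    linarith
  refine lt_of_le_of_ne hle fun heq => hne ?_
  have habs : |ζ.re| = ‖ζ‖ := by rw [← heq, h1, abs_neg, abs_one]
  have him : ζ.im = 0 := abs_re_eq_norm.1 habs
  exact Complex.ext (by simpa using heq.symm) (by simpa using him)

/-- A unit complex number other than `± 1` has non-zero imaginary part. [folklore] -/
theorem im_ne_zero_of_unit {ζ : ℂ} (h1 : ‖ζ‖ = 1) (hne : ζ ≠ 1) (hne' : ζ ≠ -1) : ζ.im ≠ 0 := by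
  intro him
  have habs : |ζ.re| = 1 := by rw [abs_re_eq_norm.2 him, h1]
  rcases abs_eq (zero_le_one' ℝ) |>.1 habs with h | h
  · exact hne (Complex.ext (by simpa using h) (by simpa using him))
  · exact hne' (Complex.ext (by simpa using h) (by simpa using him))

/-! ### 3. Genuine zigzag corners are wedges -/

/-- **Genuine zigzag corners are wedges.** For `n_{k'} ≠ ± n_k` there are `ψ` and
`0 < θ < 1 < θ' < 2` with `H_k ∩ H_{k'} = {w ≠ c, |arg((w-c)e^{-iψ})| < θπ/2}` and
`H_k ∪ H_{k'} = {w ≠ c, |arg((w-c)e^{-iψ})| < θ'π/2}` (`e^{iψ}` the bisector `(n_k+n_{k'})/‖·‖`,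
`θ = 1 - 2|γ|/π`, `θ' = 1 + 2|γ|/π`, `e^{iγ} = n_k e^{-iψ}`). [folklore] -/
theorem wedge_presentation {k k' : Fin 6} (hk : innerNormal k' ≠ innerNormal k)
    (hk' : innerNormal k' ≠ -innerNormal k) (c : ℂ) :
    ∃ ψ θ θ' : ℝ, 0 < θ ∧ θ < 1 ∧ 1 < θ' ∧ θ' < 2 ∧
      halfPlane k c ∩ halfPlane k' c =
        {w : ℂ | w ≠ c ∧ |Complex.arg ((w - c) * Complex.exp (-(ψ : ℂ) * Complex.I))| < θ * Real.pi / 2} ∧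
      halfPlane k c ∪ halfPlane k' c =
        {w : ℂ | w ≠ c ∧ |Complex.arg ((w - c) * Complex.exp (-(ψ : ℂ) * Complex.I))| < θ' * Real.pi / 2} := by
  set a : ℂ := innerNormal k with ha_def
  set b : ℂ := innerNormal k' with hb_def
  have ha : ‖a‖ = 1 := norm_innerNormal k
  have hb : ‖b‖ = 1 := norm_innerNormal k'
  have haa : a * conj a = 1 := by
    rw [mul_conj, normSq_eq_norm_sq, ha]; simp
  have hbb : b * conj b = 1 := by
    rw [mul_conj, normSq_eq_norm_sq, hb]; simp
  -- the bisector
  set m : ℂ := a + b with hm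
  have hm0 : m ≠ 0 := fun h => hk' (eq_neg_of_add_eq_zero_right h)
  have hmn : (‖m‖ : ℂ) ≠ 0 := ofReal_ne_zero.2 (norm_ne_zero_iff.2 hm0)
  set ψ : ℝ := arg m with hψ
  have hexpψ : exp ((ψ : ℂ) * I) = m / ‖m‖ := by
    rw [eq_div_iff hmn, mul_comm, hψ, norm_mul_exp_arg_mul_I]
  set e : ℂ := exp (-(ψ : ℂ) * I) with he_def
  have he : e = conj m / ‖m‖ := by
    have : -(ψ : ℂ) * I = conj ((ψ : ℂ) * I) := by
      rw [map_mul, conj_ofReal, conj_I]; ring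
    rw [he_def, this, exp_conj, hexpψ, map_div₀, conj_ofReal]
  have hee : e * conj e = 1 := by
    rw [mul_conj, normSq_eq_norm_sq, he_def, show -(ψ : ℂ) * I = ((-ψ : ℝ) : ℂ) * I by push_cast; ring,
      norm_exp_ofReal_mul_I]; simp
  have he1 : ‖e‖ = 1 := by
    rw [he_def, show -(ψ : ℂ) * I = ((-ψ : ℝ) : ℂ) * I by push_cast; ring, norm_exp_ofReal_mul_I]
  have he0 : e ≠ 0 := norm_ne_zero_iff.1 (by rw [he1]; exact one_ne_zero)
  -- the half-angle unit `p = a e`, with `b e = conj p`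
  set p : ℂ := a * e with hp_def
  have hp1 : ‖p‖ = 1 := by rw [hp_def, norm_mul, ha, he1, one_mul]
  have hbe : b * e = conj p := by
    rw [hp_def, he, map_mul, map_div₀, conj_conj, conj_ofReal, mul_div_assoc', mul_div_assoc',
      div_eq_div_iff hmn hmn, hm, map_add]
    have h1 : conj a * a = 1 := by rw [mul_comm, haa]
    linear_combination (‖a + b‖ : ℂ) * (hbb - h1)
  have hconja : conj a = conj p * e := by
    rw [hp_def, map_mul]
    linear_combination -conj a * hee
  have hconjb : conj b = p * e := by
    have : conj (b * e) = p := by rw [hbe, conj_conj]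
    rw [map_mul] at this
    linear_combination e * this - conj b * hee
  -- `p` lies in the open right half-plane, off the real axis
  have hpm : p * (‖m‖ : ℂ) = 1 + a * conj b := by
    rw [hp_def, he, mul_assoc, div_mul_cancel₀ _ hmn, hm, map_add, mul_add, haa]
  have hζ1 : ‖a * conj b‖ = 1 := by rw [norm_mul, norm_conj, ha, hb, mul_one]
  have hζne : a * conj b ≠ -1 := by
    intro h
    apply hk'
    show b = -a
    have : a * conj b * b = -b := by rw [h]; ring
    rw [mul_assoc, mul_comm (conj b) b, hbb, mul_one] at this
    rw [this, neg_neg]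
  have hζne' : a * conj b ≠ 1 := by
    intro h
    apply hk
    show b = a
    have : a * conj b * b = b := by rw [h]; ring
    rw [mul_assoc, mul_comm (conj b) b, hbb, mul_one] at this
    exact this.symm
  have hmpos : 0 < ‖m‖ := norm_pos_iff.2 hm0
  have hpre : 0 < p.re := by
    have h1 : (p * (‖m‖ : ℂ)).re = p.re * ‖m‖ := by rw [mul_comm, re_ofReal_mul, mul_comm]
    have h2 : (1 + a * conj b).re = 1 + (a * conj b).re := by simp
    have h3 := neg_one_lt_re_of_unit hζ1 hζne
    have h4 : 0 < p.re * ‖m‖ := by rw [← h1, hpm, h2]; linarith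
    exact pos_of_mul_pos_left h4 hmpos.le
  have hpim : p.im ≠ 0 := by
    have h1 : (p * (‖m‖ : ℂ)).im = p.im * ‖m‖ := by rw [mul_comm, im_ofReal_mul, mul_comm]
    have h2 : (1 + a * conj b).im = (a * conj b).im := by simp
    have h3 := im_ne_zero_of_unit hζ1 hζne' hζne
    intro h0
    have : (p * (‖m‖ : ℂ)).im = 0 := by rw [h1, h0, zero_mul]
    rw [hpm, h2] at this
    exact h3 this
  set γ : ℝ := arg p with hγ_def
  have hγ : |γ| < Real.pi / 2 := abs_arg_lt_pi_div_two_iff.2 (Or.inl hpre)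
  have hγ0 : γ ≠ 0 := fun h => hpim (arg_eq_zero_iff.1 h).2
  have hγpos : 0 < |γ| := abs_pos.2 hγ0
  have hpexp : p = exp ((γ : ℂ) * I) := by
    rw [hγ_def, ← one_mul (exp _), ← ofReal_one, ← hp1, norm_mul_exp_arg_mul_I]
  have hconjp : conj p = exp (-(γ : ℂ) * I) := by
    rw [hpexp, ← exp_conj, map_mul, conj_ofReal, conj_I]; ring_nf
  -- the openings
  refine ⟨ψ, 1 - 2 * |γ| / Real.pi, 1 + 2 * |γ| / Real.pi, ?_, ?_, ?_, ?_, ?_, ?_⟩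
  · have : 2 * |γ| / Real.pi < 1 := by rw [div_lt_one Real.pi_pos]; linarith
    linarith
  · have : 0 < 2 * |γ| / Real.pi := by positivity
    linarith
  · have : 0 < 2 * |γ| / Real.pi := by positivity
    linarith
  · have : 2 * |γ| / Real.pi < 1 := by rw [div_lt_one Real.pi_pos]; linarith
    linarith
  · -- the convex corner
    have hθ : (1 - 2 * |γ| / Real.pi) * Real.pi / 2 = Real.pi / 2 - |γ| := by
      field_simp
    rw [hθ]
    ext w
    simp only [mem_inter_iff, mem_halfPlane_iff_level, mem_setOf_eq]
    by_cases hw : w = c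
    · simp [hw]
    · set x : ℂ := (w - c) * e with hx
      have hx0 : x ≠ 0 := mul_ne_zero (sub_ne_zero.2 hw) he0
      have hxn : 0 < ‖x‖ := norm_pos_iff.2 hx0
      set η : ℝ := arg x with hη
      have hxexp : x = ‖x‖ * exp ((η : ℂ) * I) := by rw [hη, norm_mul_exp_arg_mul_I]
      have hxp : x * conj p = (‖x‖ : ℂ) * exp (((η - γ : ℝ) : ℂ) * I) := by
        rw [hconjp]
        conv_lhs => rw [hxexp]
        rw [mul_assoc, ← exp_add]
        congr 2
        push_cast
        ring
      have hxp' : x * p = (‖x‖ : ℂ) * exp (((η + γ : ℝ) : ℂ) * I) := by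
        rw [hpexp]
        conv_lhs => rw [hxexp]
        rw [mul_assoc, ← exp_add]
        congr 2
        push_cast
        ring
      have h1 : ((w - c) * conj a).re = ‖x‖ * Real.cos (η - γ) := by
        rw [hconja, show (w - c) * (conj p * e) = x * conj p by rw [hx]; ring, hxp,
          re_ofReal_mul, exp_ofReal_mul_I_re]
      have h2 : ((w - c) * conj b).re = ‖x‖ * Real.cos (η + γ) := by
        rw [hconjb, show (w - c) * (p * e) = x * p by rw [hx]; ring, hxp',
          re_ofReal_mul, exp_ofReal_mul_I_re]
      rw [h1, h2, mul_pos_iff_of_pos_left hxn, mul_pos_iff_of_pos_left hxn,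
        cos_and_cos_pos_iff (abs_arg_le_pi x) hγ, ← hη]
      simp [hw]
  · -- the reflex corner
    have hθ : (1 + 2 * |γ| / Real.pi) * Real.pi / 2 = Real.pi / 2 + |γ| := by
      field_simp
    rw [hθ]
    ext w
    simp only [mem_union, mem_halfPlane_iff_level, mem_setOf_eq]
    by_cases hw : w = c
    · simp [hw]
    · set x : ℂ := (w - c) * e with hx
      have hx0 : x ≠ 0 := mul_ne_zero (sub_ne_zero.2 hw) he0
      have hxn : 0 < ‖x‖ := norm_pos_iff.2 hx0
      set η : ℝ := arg x with hη
      have hxexp : x = ‖x‖ * exp ((η : ℂ) * I) := by rw [hη, norm_mul_exp_arg_mul_I]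
      have hxp : x * conj p = (‖x‖ : ℂ) * exp (((η - γ : ℝ) : ℂ) * I) := by
        rw [hconjp]
        conv_lhs => rw [hxexp]
        rw [mul_assoc, ← exp_add]
        congr 2
        push_cast
        ring
      have hxp' : x * p = (‖x‖ : ℂ) * exp (((η + γ : ℝ) : ℂ) * I) := by
        rw [hpexp]
        conv_lhs => rw [hxexp]
        rw [mul_assoc, ← exp_add]
        congr 2
        push_cast
        ring
      have h1 : ((w - c) * conj a).re = ‖x‖ * Real.cos (η - γ) := by
        rw [hconja, show (w - c) * (conj p * e) = x * conj p by rw [hx]; ring, hxp,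
          re_ofReal_mul, exp_ofReal_mul_I_re]
      have h2 : ((w - c) * conj b).re = ‖x‖ * Real.cos (η + γ) := by
        rw [hconjb, show (w - c) * (p * e) = x * p by rw [hx]; ring, hxp',
          re_ofReal_mul, exp_ofReal_mul_I_re]
      rw [h1, h2, mul_pos_iff_of_pos_left hxn, mul_pos_iff_of_pos_left hxn,
        cos_or_cos_pos_iff (abs_arg_le_pi x) hγ, ← hη]
      simp [hw]

/-! ### Registered form -/

/-- **Registered helper `phaseBookkeeping_wedge`** (∀-closed form of `wedge_presentation`;
sub-goal of stub `boundaryPhaseBookkeeping`, crux stmt-CriticalPhenomena-14004, line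
`polygon-parity-squeeze`): genuine zigzag corners are wedges. [folklore] -/
theorem phaseBookkeeping_wedge : ∀ (k k' : Fin 6) (c : ℂ), innerNormal k' ≠ innerNormal k → innerNormal k' ≠ -innerNormal k → ∃ ψ θ θ' : ℝ, 0 < θ ∧ θ < 1 ∧ 1 < θ' ∧ θ' < 2 ∧ halfPlane k c ∩ halfPlane k' c = {w : ℂ | w ≠ c ∧ |Complex.arg ((w - c) * Complex.exp (-(ψ : ℂ) * Complex.I))| < θ * Real.pi / 2} ∧ halfPlane k c ∪ halfPlane k' c = {w : ℂ | w ≠ c ∧ |Complex.arg ((w - c) * Complex.exp (-(ψ : ℂ) * Complex.I))| < θ' * Real.pi / 2} :=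
  fun _ _ c hk hk' => wedge_presentation hk hk' c

end PhaseGeometry

end Summit.CriticalPhenomena.SAWScalingLimit.Theorems.PolygonParitySqueeze

end
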